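import Mathlib
import Summits.Ventures.PercRepro2.Harris
import Summits.Ventures.PercRepro2.BasePrime
import Summits.Ventures.PercRepro2.LocRows
import Summits.Ventures.PercRepro2.SwRow
import Summits.Ventures.PercRepro2.SwOut
import Summits.Ventures.PercRepro2.SwAllRow
import Summits.Ventures.PercRepro2.SwOutAll
import Summits.Ventures.PercRepro2.SwOutCube
import Summits.Ventures.PercRepro2.SwOutArmFlip
import Summits.Ventures.PercRepro2.SwOutArms
import Summits.Ventures.PercRepro2.SwOutArmOrbit
import Summits.Ventures.PercRepro2.SwOutArmCube
import Summits.Ventures.PercRepro2.SwOutArmThm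
import Summits.Ventures.PercRepro2.SwOutCoreDefs
import Summits.Ventures.PercRepro2.SwOutCoreHull
import Summits.Ventures.PercRepro2.SwOutCoreDual

/-!
# THE CORE CUBE INEQUALITY (blind cell PercRepro2, night-4 g13, 2026-08-26;
proofs/NIGHT4-G12.md §3 (L1–L3), proofs/NIGHT4-G13.md §2)

On the core cube of a core base — the realisations `coreReal ζ ω` of all cube points — the red
edge set of `h` is increasing in the cube point (`redEdges_coreReal_mono`), the blue edge set
decreasing (`blueEdges_coreReal_anti`), the flip of the cube exchanges them
(`blueEdges_coreReal_flipAll`), and the conditioning `Q` pulls back to a lower set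
(`coreReal_mem_tgtU_of_le`).  The cube principle in its edge-set form (`card_le_of_cube_edges`)
then gives the rigid counting inequality on the core cube (**`card_coreCube_le`**): the first
block of Theorem A of NIGHT4-G12.md in the kernel — the vertex `u` is a core of `h` on part of the
cube.
-/

namespace Summit.Ventures.PercRepro2

namespace LocRows

open Hull

variable {V : Type*} {E : Type*}

open scoped Classical

variable {ends : E → Sym2 V}

section Edges

variable {ι : Type*} {A : ι → Set V} {pure : ι → Prop} {ζ : Config E} {h u : V} {H : Set V}
  (hb : CoreBase ends ζ h u H A pure)
include hb

/-- An edge inside `redSet ω` has an end in a red arm. -/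
lemma CoreBase.exists_red_arm_of_within_redSet {ω : Config ι} {e : E}
    (hw : e ∈ within ends (redSet ends A h u pure ω)) :
    ∃ i x y, ends e = s(x, y) ∧ x ∈ A i ∧ ω i = true := by
  obtain ⟨x, hx, y, hy, hxy⟩ := hw
  -- an end in an arm is in a red arm
  have key : ∀ z ∈ redSet ends A h u pure ω, ∀ i, z ∈ A i → ω i = true := by
    intro z hz i hzi
    rw [mem_redSet_iff] at hz
    rcases hz with rfl | ⟨j, hj, _, hzj⟩ | ⟨_, rfl | ⟨j, hj, _, hzj⟩⟩
    · exact absurd hzi (hb.h_notMem_arm i)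
    · have : j = i := by
        by_contra hne
        exact hb.arm_disj j i hne z hzj hzi
      exact this ▸ hj
    · exact absurd hzi (hb.u_notMem_arm i)
    · have : j = i := by
        by_contra hne
        exact hb.arm_disj j i hne z hzj hzi
      exact this ▸ hj
  by_cases hxA : ∃ i, x ∈ A i
  · obtain ⟨i, hxi⟩ := hxA
    exact ⟨i, x, y, hxy, hxi, key x hx i hxi⟩
  by_cases hyA : ∃ i, y ∈ A i
  · obtain ⟨i, hyi⟩ := hyA
    exact ⟨i, y, x, ends_swap hxy, hyi, key y hy i hyi⟩
  exfalso
  -- neither end is in an arm: both are `h` or `u`, an impossible edge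
  have hxhu : x = h ∨ x = u := by
    rw [mem_redSet_iff] at hx
    rcases hx with rfl | ⟨j, _, _, hxj⟩ | ⟨_, rfl | ⟨j, _, _, hxj⟩⟩
    · exact Or.inl rfl
    · exact absurd ⟨j, hxj⟩ hxA
    · exact Or.inr rfl
    · exact absurd ⟨j, hxj⟩ hxA
  have hyhu : y = h ∨ y = u := by
    rw [mem_redSet_iff] at hy
    rcases hy with rfl | ⟨j, _, _, hyj⟩ | ⟨_, rfl | ⟨j, _, _, hyj⟩⟩
    · exact Or.inl rfl
    · exact absurd ⟨j, hyj⟩ hyA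
    · exact Or.inr rfl
    · exact absurd ⟨j, hyj⟩ hyA
  rcases hxhu with rfl | rfl <;> rcases hyhu with rfl | rfl
  · exact hb.loop_h e hxy
  · exact hb.no_hu e hxy
  · exact hb.no_hu e (ends_swap hxy)
  · exact hb.loop_u e hxy

/-- The colour of an edge inside `redSet ω` does not change going up the cube. -/
lemma CoreBase.coreReal_apply_eq_of_within_redSet {ω ω' : Config ι} (hω : ω ≤ ω') {e : E}
    (hw : e ∈ within ends (redSet ends A h u pure ω)) :
    coreReal ends A ζ ω' e = coreReal ends A ζ ω e := by
  obtain ⟨i, x, y, hxy, hxi, hi⟩ := hb.exists_red_arm_of_within_redSet hw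
  have hi' : ω' i = true := by
    have := hω i
    rw [hi] at this
    cases h' : ω' i
    · rw [h'] at this; exact absurd this (by simp)
    · rfl
  rw [hb.coreReal_apply_of_mem hxy hxi, hb.coreReal_apply_of_mem hxy hxi, if_pos hi, if_pos hi']

/-- **The red edge set of `h` grows with the cube point.** -/
theorem CoreBase.redEdges_coreReal_mono {ω ω' : Config ι} (hω : ω ≤ ω') :
    redEdges ends (coreReal ends A ζ ω) h ⊆ redEdges ends (coreReal ends A ζ ω') h := by
  intro e he
  rw [mem_redEdges] at he ⊢
  obtain ⟨hred, hw⟩ := he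
  rw [hb.cluster_coreReal] at hw
  refine ⟨?_, ?_⟩
  · rw [hb.coreReal_apply_eq_of_within_redSet hω hw]; exact hred
  · obtain ⟨x, hx, y, hy, hxy⟩ := hw
    exact ⟨x, hb.cluster_coreReal_mono hω (by rw [hb.cluster_coreReal]; exact hx), y,
      hb.cluster_coreReal_mono hω (by rw [hb.cluster_coreReal]; exact hy), hxy⟩

/-- **The blue edge set of `h` shrinks with the cube point.** -/
theorem CoreBase.blueEdges_coreReal_anti {ω ω' : Config ι} (hω : ω ≤ ω') :
    blueEdges ends (coreReal ends A ζ ω') h ⊆ blueEdges ends (coreReal ends A ζ ω) h := by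
  unfold blueEdges
  rw [hb.blue_coreReal, hb.blue_coreReal]
  exact hb.dual.redEdges_coreReal_mono (flipAll_le_flipAll hω)

/-- The red edge sets of `h` of the base and of the dual base agree at every cube point. -/
lemma CoreBase.redEdges_coreReal_dual (ω : Config ι) :
    redEdges ends (coreReal ends A (dualBase ends A ζ) ω) h =
      redEdges ends (coreReal ends A ζ ω) h := by
  ext e
  rw [mem_redEdges, mem_redEdges, hb.cluster_coreReal, hb.dual.cluster_coreReal]
  constructor
  · rintro ⟨hred, hw⟩
    refine ⟨?_, hw⟩
    obtain ⟨i, x, y, hxy, hxi, hi⟩ := hb.exists_red_arm_of_within_redSet hw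
    rw [hb.dual.coreReal_apply_of_mem hxy hxi, if_pos hi,
      dualBase_apply_of_mem (CoreBase.touches_allArms_of_mem hxy hxi)] at hred
    rw [hb.coreReal_apply_of_mem hxy hxi, if_pos hi]; exact hred
  · rintro ⟨hred, hw⟩
    refine ⟨?_, hw⟩
    obtain ⟨i, x, y, hxy, hxi, hi⟩ := hb.exists_red_arm_of_within_redSet hw
    rw [hb.coreReal_apply_of_mem hxy hxi, if_pos hi] at hred
    rw [hb.dual.coreReal_apply_of_mem hxy hxi, if_pos hi,
      dualBase_apply_of_mem (CoreBase.touches_allArms_of_mem hxy hxi)]; exact hred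

/-- **The flip of the cube exchanges the red and the blue edge sets.** -/
theorem CoreBase.blueEdges_coreReal_flipAll (ω : Config ι) :
    blueEdges ends (coreReal ends A ζ (flipAll ω)) h = redEdges ends (coreReal ends A ζ ω) h := by
  unfold blueEdges
  rw [hb.blue_coreReal, flipAll_involutive ω]
  exact hb.redEdges_coreReal_dual ω

end Edges

section Cube

variable [Fintype E] [DecidableEq E]
variable {ι : Type*} {A : ι → Set V} {pure : ι → Prop} {ζ : Config E} {h u : V} {H : Set V}
  (hb : CoreBase ends ζ h u H A pure)
include hb

/-- **The conditioning `Q` pulls back to a lower set of the core cube** (`l ∉ H`). -/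
theorem CoreBase.coreReal_mem_tgtU_of_le {l o : V} (hl : l ∉ H) {ω ω' : Config ι} (hω : ω ≤ ω')
    (hQ : coreReal ends A ζ ω' ∈ tgtU ends l h {S : Set V | o ∈ S}) :
    coreReal ends A ζ ω ∈ tgtU ends l h {S : Set V | o ∈ S} := by
  simp only [tgtU, Finset.mem_filter, Finset.mem_univ, true_and, Set.mem_setOf_eq, hull,
    Set.mem_union, not_or] at hQ ⊢
  obtain ⟨⟨_, _⟩, hoA, hoB⟩ := hQ
  refine ⟨⟨?_, ?_⟩, ?_, ?_⟩
  · intro hh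
    exact hl (hb.cluster_coreReal_subset ω (conn_symm hh))
  · intro hh
    exact hl (hb.hull_coreReal_subset ω (Or.inr (conn_symm hh)))
  · exact hb.cluster_l_coreReal_anti hl hω hoA
  · exact fun h' => hoB (hb.cluster_blue_l_coreReal_mono hl hω h')

omit hb in
variable (ends A ζ) in
/-- The core cube: the realisations of all cube points. -/
noncomputable def coreCube [Fintype ι] : Finset (Config E) :=
  Finset.univ.image (coreReal ends A ζ)

omit [DecidableEq E] hb in
/-- Membership in the core cube. -/
lemma mem_coreCube [Fintype ι] {ζ' : Config E} :
    ζ' ∈ coreCube ends A ζ ↔ ∃ ω, coreReal ends A ζ ω = ζ' := by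
  simp only [coreCube, Finset.mem_image, Finset.mem_univ, true_and]

/-- **THE CORE CUBE INEQUALITY**: the rigid counting inequality on the core cube of a core base
(`H ⊆ U`, `l ∉ U`), for every up-set `𝓔` of edge sets. -/
theorem CoreBase.card_coreCube_le [Fintype ι] {U : Set V} {l o : V} (hHU : H ⊆ U) (hl : l ∉ U)
    {𝓔 : Set (Set E)} (h𝓔 : IsUpperSet 𝓔) :
    ((coreCube ends A ζ).filter fun ζ' =>
        ζ' ∈ tgtU ends l h {S : Set V | o ∈ S} ∧ redEdges ends ζ' h ∈ 𝓔).card ≤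
      ((coreCube ends A ζ).filter fun ζ' =>
        ζ' ∈ tgtU ends l h {S : Set V | o ∈ S} ∧ blueEdges ends ζ' h ∈ 𝓔).card := by
  have hlH : l ∉ H := fun h' => hl (hHU h')
  have key := card_le_of_cube_edges (ends := ends) (coreReal ends A ζ) hb.coreReal_injective
    (coreCube ends A ζ) (fun ζ' => mem_coreCube)
    (↑(tgtU ends l h {S : Set V | o ∈ S}))
    (fun ω' ω hω hQ => hb.coreReal_mem_tgtU_of_le hlH hω hQ) h
    (fun 𝓔' h𝓔' ω ω' hω hω𝓔 => h𝓔' (hb.redEdges_coreReal_mono hω) hω𝓔)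
    (fun 𝓔' h𝓔' ω' ω hω hω𝓔 => h𝓔' (hb.blueEdges_coreReal_anti hω) hω𝓔)
    (fun ω => hb.blueEdges_coreReal_flipAll ω) h𝓔
  simpa only [Finset.mem_coe] using key

end Cube

end LocRows

end Summit.Ventures.PercRepro2
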